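import Summits.CriticalPhenomena.PercolationContinuityZ3.Theorems.PercNearOneGluingNoHeavyQuantGluedWindowNoTopHeavy
import Summits.CriticalPhenomena.PercolationContinuityZ3.Theorems.PercNearOneGluingNoHeavyQuantGluedWindowNoTopLight
import Summits.CriticalPhenomena.PercolationContinuityZ3.Theorems.PercNearOneGluingNoHeavyQuantGluedWindowNoTopGiantMinus
import Summits.CriticalPhenomena.PercolationContinuityZ3.Theorems.PercNearOneGluingNoHeavyQuantGluedWindowLightInc
import Summits.CriticalPhenomena.PercolationContinuityZ3.Theorems.PercNearOneGluingNoHeavyQuantGluedWindowPoolOnly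
import HarnessLib

/-!
# QUANT lane R8, T-DEC: LEMMA W's pair condition — ASSEMBLY of the two-row h-mid regime with the TOP COPY UNREACHABLE (`2l + r + k ≤ T`): every
# such configuration satisfies the pair condition, whatever the statuses of the copies — arm-1 g61's open sliver (a) closed by the DIAGONAL certificate,
# plus `…_lightInc` (g61) and `…_poolOnly` (g59) (arm-1 gen 62, architect)

builds on p205010 (kernel theorem, internal audit signed; external expert review pending)

Support file (`--supports stmt-CriticalPhenomena-4575`), QUANT lane seat prim-quant-arm-1 (gen 62, architect); memo
`run/shared/lean/prim/quant/prim-quant-arm-1-g62/ARCH-G62.md` §0, §5.  Theorems only; standard axioms, no sorries, no definitions.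

* **`gluedPullback_windowPair_twoRow_noTop`** — the open sliver (a) of arm-1 g61's case tree (ARCH-G61 §8): `2l+r+k ≤ T`, `y(h−l) ≤ T−2l < h−l+r`:
  case split `h+r ≤ j` & `h+r` heavy for the middle copy → `…_noTop_heavyG` (p641292); `h+r ≤ j` & light → `…_noTop_lightG`; `j < h+r` →
  `…_noTop_giant` (= `…_giantG` p642893 ∪ `…_giantG_minus`).  The cell inequalities are `diag_twoCopy` (Lemma D), `diag_lightMinus`, `diag_lightPlus`,
  `diag_poolLight`, `diag_poolMinus` (`…DiagCore`, `…DiagLight`, `…DiagLightBig`, `…NoTopGiant`, `…DiagPoolMinus`).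
* **`gluedPullback_windowPair_twoRow_noTopCopy`** — the WHOLE top-copy-unreachable half of the two-row h-mid regime: `2l+r+k ≤ T` alone ⟹ the pair
  condition: `T−2l ≤ y(h−l)` → `…_twoRow_lightInc` (arm-1 g61, p622867); `l+r+h ≤ T` → `…_twoRow_poolOnly` (arm-1 g59, p604777); else `…_noTop`.
With arm-1 g61's `…_twoRow_topFit` (p636733) and `…_farH` (p632451) the h-mid half of LEMMA W's two-row regime is now kernel EXCEPT the non-fitting heavy
middle copy with the top copy reachable (`T < 2l+r+k`, `yk < T−2l−2r`, `qg(2l+2r+k−T) < q(1−g)(T−2l−2r)`, `T−2l < h−l+r`; memo §5).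

HONEST STATUS.  `GluedLemmaW` (flow form), `GluedDominatedMass`, the band, `SiblingStep`, `FarTreeRow` OPEN; RATE class (log\*) / honest sentence of
`run/shared/lean/prim/quant/README.md` unchanged.  [this work].  Nothing here is cited as a published result.  The gluing rows served
[cite: KozmaNitzan2024, Conjecture 3 (p. 15)]; product measure [cite: Grimmett1999, §1.3 p. 10].
-/

noncomputable section

namespace Summit.CriticalPhenomena.PercolationContinuityZ3.Theorems
namespace Quant
namespace LawDec

/-- **SLIVER (a) OF THE TWO-ROW h-MID REGIME**: `2l + r + k ≤ T` (top copy unreachable), `y(h−l) ≤ T − 2l` (pair heavy or incompatible at `T`),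
`T < l + r + h` (middle copy reaches `h`) ⟹ `(1−γ)Ψ(l) + γΨ(h) ≤ 0` for every price system and every cheap `c ≥ h`; no status hypothesis,
no `GluedLemmaW`. [this work] -/
theorem gluedPullback_windowPair_twoRow_noTop (x a q g S : ℝ) (B r k j l h c ls : ℕ) (α p : ℕ → ℝ)
    (hx0 : 0 < x) (hx1 : x < 1) (ha0 : 0 < a) (ha1 : a ≤ 1) (hq0 : 0 < q) (hq1 : q < 1) (hg0 : 0 ≤ g) (hg1 : g ≤ 1) (hr : 1 ≤ r)
    (hxqg : x ≤ q * g) (hband1 : 2 * (r : ℝ) < q * ((r : ℝ) + k * g)) (hband2 : q * ((r : ℝ) + k * g) - r < (k : ℝ) * x)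
    (hlh : l < h) (hhB : h ≤ B) (hhj : h ≤ j) (hwin : j < h + r + k) (hlow : 2 * (l : ℝ) < a * S) (hcomp : a * S < (l : ℝ) + h)
    (hlight : pairGate (a * x) (a * S) l h < a * x)
    (hL2j : l + r + k ≤ j) (hL2mid : a * (S + q * ((r : ℝ) + k * g)) ≤ 2 * ((l : ℝ) + r + k))
    (hL1low : 2 * ((l : ℝ) + r) < a * (S + q * ((r : ℝ) + k * g))) (hhmid : a * (S + q * ((r : ℝ) + k * g)) ≤ 2 * (h : ℝ))
    (hincl : 2 * (l : ℝ) + r + k ≤ a * (S + q * ((r : ℝ) + k * g)))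
    (hheavyT : (a * x) * ((h : ℝ) - l) ≤ a * (S + q * ((r : ℝ) + k * g)) - 2 * (l : ℝ))
    (hcompat1 : a * (S + q * ((r : ℝ) + k * g)) < (l : ℝ) + r + h)
    (hhc : h ≤ c) (hcB : c ≤ B) (hcj : c ≤ j)
    (hp : ∀ h, 0 ≤ p h)
    (hαp : ∀ l' h', l' ≤ j → 2 * (l' : ℝ) < a * (S + q * ((r : ℝ) + k * g)) → h' ≤ B + (r + k) →
      (j + 1 ≤ h' ∨ a * (S + q * ((r : ℝ) + k * g)) < (l' : ℝ) + h') →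
      α l' ≤ usage (a * x) (a * (S + q * ((r : ℝ) + k * g))) j l' h' * p h')
    (hcheap : -(gluedPullback (a * (S + q * ((r : ℝ) + k * g))) q g j r k α p c) * (a * x)
      < (1 - a * x) * gluedPullback (a * (S + q * ((r : ℝ) + k * g))) q g j r k α p ls) :
    (1 - pairGate (a * x) (a * S) l h) * gluedPullback (a * (S + q * ((r : ℝ) + k * g))) q g j r k α p l
      + pairGate (a * x) (a * S) l h * gluedPullback (a * (S + q * ((r : ℝ) + k * g))) q g j r k α p h ≤ 0 := by
  by_cases hjr : h + r ≤ j
  · by_cases hG : (a * x) * ((h : ℝ) - l) ≤ a * (S + q * ((r : ℝ) + k * g)) - 2 * ((l : ℝ) + r)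
    · exact gluedPullback_windowPair_twoRow_noTop_heavyG x a q g S B r k j l h c ls α p hx0 hx1 ha0 ha1 hq0 hq1 hg0 hg1 hr hxqg hlh hhB hhj
        hwin hlow hcomp hlight hL2j hL2mid hL1low hhmid hincl hheavyT hcompat1 hjr hG hhc hcB hcj hp hαp hcheap
    · exact gluedPullback_windowPair_twoRow_noTop_lightG x a q g S B r k j l h c ls α p hx0 hx1 ha0 ha1 hq0 hq1 hg0 hg1 hr hxqg hband1 hband2
        hlh hhB hhj hwin hlow hcomp hlight hL2j hL2mid hL1low hhmid hincl hheavyT hcompat1 hjr (lt_of_not_ge hG) hhc hcB hcj hp hαp hcheap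
  · exact gluedPullback_windowPair_twoRow_noTop_giant x a q g S B r k j l h c ls α p hx0 hx1 ha0 ha1 hq0 hq1 hg0 hg1 hr hxqg hlh hhB hhj
      hwin hlow hcomp hlight hL2j hL2mid hL1low hhmid hincl hheavyT hcompat1 (by omega) hhc hcB hcj hp hαp hcheap

/-- **THE TOP-COPY-UNREACHABLE HALF OF THE TWO-ROW h-MID REGIME**: `2l + r + k ≤ T` ⟹ `(1−γ)Ψ(l) + γΨ(h) ≤ 0` for every price system and every cheap
`c ≥ h` — `…_twoRow_lightInc` (pair light at `T`) ∪ `…_twoRow_poolOnly` (`l + r + h ≤ T`) ∪ `…_twoRow_noTop`; no status hypothesis, no `GluedLemmaW`.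
[this work] -/
theorem gluedPullback_windowPair_twoRow_noTopCopy (x a q g S : ℝ) (B r k j l h c ls : ℕ) (α p : ℕ → ℝ)
    (hx0 : 0 < x) (hx1 : x < 1) (ha0 : 0 < a) (ha1 : a ≤ 1) (hq0 : 0 < q) (hq1 : q < 1) (hg0 : 0 ≤ g) (hg1 : g ≤ 1) (hr : 1 ≤ r) (hk : 1 ≤ k)
    (hxqg : x ≤ q * g) (hband1 : 2 * (r : ℝ) < q * ((r : ℝ) + k * g)) (hband2 : q * ((r : ℝ) + k * g) - r < (k : ℝ) * x)
    (hlh : l < h) (hhB : h ≤ B) (hhj : h ≤ j) (hwin : j < h + r + k) (hlow : 2 * (l : ℝ) < a * S) (hcomp : a * S < (l : ℝ) + h)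
    (hlight : pairGate (a * x) (a * S) l h < a * x)
    (hL2j : l + r + k ≤ j) (hL2mid : a * (S + q * ((r : ℝ) + k * g)) ≤ 2 * ((l : ℝ) + r + k))
    (hL1low : 2 * ((l : ℝ) + r) < a * (S + q * ((r : ℝ) + k * g))) (hhmid : a * (S + q * ((r : ℝ) + k * g)) ≤ 2 * (h : ℝ))
    (hincl : 2 * (l : ℝ) + r + k ≤ a * (S + q * ((r : ℝ) + k * g)))
    (hhc : h ≤ c) (hcB : c ≤ B) (hcj : c ≤ j)
    (hp : ∀ h, 0 ≤ p h)
    (hαp : ∀ l' h', l' ≤ j → 2 * (l' : ℝ) < a * (S + q * ((r : ℝ) + k * g)) → h' ≤ B + (r + k) →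
      (j + 1 ≤ h' ∨ a * (S + q * ((r : ℝ) + k * g)) < (l' : ℝ) + h') →
      α l' ≤ usage (a * x) (a * (S + q * ((r : ℝ) + k * g))) j l' h' * p h')
    (hcheap : -(gluedPullback (a * (S + q * ((r : ℝ) + k * g))) q g j r k α p c) * (a * x)
      < (1 - a * x) * gluedPullback (a * (S + q * ((r : ℝ) + k * g))) q g j r k α p ls) :
    (1 - pairGate (a * x) (a * S) l h) * gluedPullback (a * (S + q * ((r : ℝ) + k * g))) q g j r k α p l
      + pairGate (a * x) (a * S) l h * gluedPullback (a * (S + q * ((r : ℝ) + k * g))) q g j r k α p h ≤ 0 := by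
  by_cases hlightT : a * (S + q * ((r : ℝ) + k * g)) - 2 * (l : ℝ) ≤ (a * x) * ((h : ℝ) - l)
  · exact gluedPullback_windowPair_twoRow_lightInc x a q g S B r k j l h c ls α p hx0 hx1 ha0 ha1 hq0 hq1 hg0 hg1 hr hk hxqg hlh hhB hhj hwin
      hlow hcomp hlight hL2j hL2mid hL1low hhmid hincl hlightT hhc hcB hcj hp hαp hcheap
  have hheavyT : (a * x) * ((h : ℝ) - l) ≤ a * (S + q * ((r : ℝ) + k * g)) - 2 * (l : ℝ) := (lt_of_not_ge hlightT).le
  by_cases hinch : (l : ℝ) + r + h ≤ a * (S + q * ((r : ℝ) + k * g))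
  · exact gluedPullback_windowPair_twoRow_poolOnly x a q g S B r k j l h α p hx0 hx1 ha0 ha1 hq0 hq1 hg1 hk hxqg hband2 hlh hhB hhj hwin
      hlow hcomp hlight hL2j hL2mid hL1low hincl hinch hhmid hp hαp
  · exact gluedPullback_windowPair_twoRow_noTop x a q g S B r k j l h c ls α p hx0 hx1 ha0 ha1 hq0 hq1 hg0 hg1 hr hxqg hband1 hband2 hlh hhB hhj
      hwin hlow hcomp hlight hL2j hL2mid hL1low hhmid hincl hheavyT (lt_of_not_ge hinch) hhc hcB hcj hp hαp hcheap

end LawDec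
end Quant
end Summit.CriticalPhenomena.PercolationContinuityZ3.Theorems
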